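import Summits.CriticalPhenomena.PercolationContinuityZ3.Theorems.PercNearOneGluingNoHeavyQuantIndepBlobTwoLightCellsHigh
import HarnessLib

/-!
# QUANT lane R8, T-DIB: the TOP CELL of the chord certificate for an ARBITRARY light cloud (the only cell that needs
# non-mergeability) — a real inequality

builds on p205010 (kernel theorem, internal audit signed; external expert review pending)

Support file (`--supports stmt-CriticalPhenomena-4575`), QUANT lane seat prim-quant-p1 (gen 12); memo
`run/shared/lean/prim/quant/P1-SURPLUS.md` §23.9.  Theorems only; no definitions, no sorries, standard axioms.

Setting (Conjecture J′ of the memo, case "no light blob is heavy-mergeable").  Floor `1/2 < x < 1`, level `j ≥ 1`; heavy part of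
total size `A ≤ 2j` and mean open mass `m ≥ xA`; a light cloud of total size `Bt` and credit `K = Σ_ℓ b_ℓ κ_x(g_ℓ)`, with the DIB\*
credit `2j < m + K`.  A chord `(n₁, A)` of the two-point reduction (`tail_ge_of_heavyChords`) lies in the TOP CELL when the lower
level `j + 1 − n₁` exceeds the whole light mass, `Bt ≤ j − n₁` (there `P(Λ ≥ j+1−n₁) = 0` and the upper level has value `1`); the
chord inequality is then `x(A − n₁) ≤ m − n₁`.  Two bounds on `K` are available from the cloud: `K ≤ x·Bt` (every rate `κ < x`) and,
when every light is NOT heavy-mergeable (`g_ℓ·A < j`), `(1−x)·K·A ≤ Bt·(j − x²A)` (sum of `(g_ℓ − x²)A < j − x²A` weighted by `b_ℓ`).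
`Quant.IndepBlob.cloud_topCell` proves the chord inequality from these two bounds (regimes `xA ≤ j` / `xA > j`, the latter by
`twoLight_polyC1`); for two lights it is `twoLight_cellC1`.  Numerically (memo §23.9) every OTHER cell of the certificate holds without
any mergeability hypothesis for clouds of 3–5 lights (0 failures in 37 627 exact instances), so this lemma isolates the role of
non-mergeability in Conjecture J′.  [cite: KozmaNitzan2024, Conjecture 3 (p. 15)] (the gluing rows served); [this work].
-/

namespace Summit.CriticalPhenomena.PercolationContinuityZ3.Theorems

namespace Quant

namespace IndepBlob

/-- **Top cell for an arbitrary light cloud.**  `1/2 < x < 1`, `1 ≤ j`, `0 ≤ n₁`, `xA ≤ m ≤ A`, `A ≤ 2j`, light total `0 ≤ Bt ≤ j − n₁`,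
credit bounds `K ≤ x·Bt` and `(1−x)·K·A ≤ Bt·(j − x²A)` (per-light non-mergeability), DIB\* credit `2j < m + K`
⟹ `x(A − n₁) ≤ (A − m)·0 + (m − n₁)·1`. [this work] -/
theorem cloud_topCell (x j n₁ A m K Bt : ℝ) (hx : 1 / 2 < x) (hx1 : x < 1) (hj : 1 ≤ j) (hn10 : 0 ≤ n₁)
    (hmA : x * A ≤ m) (hmA' : m ≤ A) (hA2j : A ≤ 2 * j) (hBt0 : 0 ≤ Bt) (hBt : Bt ≤ j - n₁) (hKx : K ≤ x * Bt)
    (hKA : (1 - x) * K * A ≤ Bt * (j - x ^ 2 * A)) (hcr : 2 * j < m + K) :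
    x * (A - n₁) ≤ (A - m) * 0 + (m - n₁) * 1 := by
  have hε : 0 < 1 - x := by linarith
  have hx0 : 0 < x := by linarith
  by_cases hreg : x * A ≤ j
  · have : x * Bt ≤ x * (j - n₁) := mul_le_mul_of_nonneg_left hBt hx0.le
    nlinarith
  · have hreg' : j < x * A := not_le.mp hreg
    have hA0 : 0 < A := by nlinarith
    have hK0 : 0 < K := by linarith
    -- `j − x² A ≥ 0` (else `hKA` contradicts `K, A > 0`)
    have hjx : 0 ≤ j - x ^ 2 * A := by
      by_contra h
      have h' : j - x ^ 2 * A < 0 := not_le.mp h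
      have h1 : Bt * (j - x ^ 2 * A) ≤ 0 := mul_nonpos_of_nonneg_of_nonpos hBt0 h'.le
      have h2 : 0 < (1 - x) * K * A := mul_pos (mul_pos hε hK0) hA0
      linarith
    have hKA' : (1 - x) * K * A ≤ (j - n₁) * (j - x ^ 2 * A) :=
      le_trans hKA (mul_le_mul_of_nonneg_right hBt hjx)
    have hQ := twoLight_polyC1 x j n₁ A hx hx1 hj hn10 (by linarith) hreg'.le hA2j
    have hm : (1 - x) * A * (2 * j) < (1 - x) * A * (m + K) := mul_lt_mul_of_pos_left hcr (mul_pos hε hA0)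
    have hgoal : (1 - x) * A * (x * (A - n₁)) ≤ (1 - x) * A * (m - n₁) := by nlinarith [hm, hKA', hQ]
    have h5 : 0 < (1 - x) * A := mul_pos hε hA0
    have := le_of_mul_le_mul_left hgoal h5
    linarith

end IndepBlob

end Quant

end Summit.CriticalPhenomena.PercolationContinuityZ3.Theorems
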